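import Summits.HubbardSuperconductivity.HubbardSuperconductivity.Theorems.AnisotropyChordTransferFibre3Hole2Bond

/-!
# Route `AnisotropyChord` / H0 rotor rung: HOLE₂(.75) channel checks — kernel facts for `46 ≤ L ≤ 54`

KERNEL FACTS (zero data): for each listed `L` the per-`L` channel checker `Hole2.chanCheck L` (`…Fibre3Hole2Bond`: g3's parameter
check + the enclosures of the three torus Green values `G̃_{g_L}(0,0), G̃_{g_L}(2,0), G̃_{g_L}(1,1)` by g3's `greenIv`, and the two
integer comparisons `2aKer(2,0) ≤ 1`, `4aKer(1,1) − 2aKer(2,0) ≤ 1` in walk units) returns `true`, by one `decide +kernel` each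
(`O(L²)` interval operations; `maxHeartbeats 400000` pre-budgeted as in g3's per-`L` files).  Soundness
(`Hole2.twoHoleGap_of_chanCheck : chanCheck L = true → TwoHoleGap L (3/4·eps1 L)`) is `…Fibre3Hole2Chan`; the ∀`L ≥ 9` assembly is
`…Fibre3Hole2AllL` (`9…36`: g3's kernel certificates; `37…63`: these facts; `≥ 64`: analytic, `…Fibre3Hole2Large`).
Prover seat `hubbard-h0-rotor-p3` g4; helper for stmt-HubbardSuperconductivity-19089 (`--supports`, helper class).
WHAT THIS IS NOT: nothing here proves superconductivity in the Hubbard model (rotor TARGET as worded stays FALSE, g15 verdict);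
kernel facts for ONE input (HOLE₂(.75)) of ONE conditional reduction (rung 19089). Tree imports only; no sorry, no `native_decide`.
-/

set_option linter.dupNamespace false
set_option autoImplicit false

namespace Summit.HubbardSuperconductivity.HubbardSuperconductivity.Theorems.AnisotropyChord.Transfer.Fibre3

namespace Hole2

set_option maxHeartbeats 400000 in
/-- kernel fact: the channel check passes at `L = 46` (`2aKer(2,0) ≤ 1`, `4aKer(1,1) − 2aKer(2,0) ≤ 1` at `g_46 ≥ ¾ε₁(46)`). [folklore] -/
theorem chanCheck_46 : chanCheck 46 = true := by
  decide +kernel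

set_option maxHeartbeats 400000 in
/-- kernel fact: the channel check passes at `L = 47` (`2aKer(2,0) ≤ 1`, `4aKer(1,1) − 2aKer(2,0) ≤ 1` at `g_47 ≥ ¾ε₁(47)`). [folklore] -/
theorem chanCheck_47 : chanCheck 47 = true := by
  decide +kernel

set_option maxHeartbeats 400000 in
/-- kernel fact: the channel check passes at `L = 48` (`2aKer(2,0) ≤ 1`, `4aKer(1,1) − 2aKer(2,0) ≤ 1` at `g_48 ≥ ¾ε₁(48)`). [folklore] -/
theorem chanCheck_48 : chanCheck 48 = true := by
  decide +kernel

set_option maxHeartbeats 400000 in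
/-- kernel fact: the channel check passes at `L = 49` (`2aKer(2,0) ≤ 1`, `4aKer(1,1) − 2aKer(2,0) ≤ 1` at `g_49 ≥ ¾ε₁(49)`). [folklore] -/
theorem chanCheck_49 : chanCheck 49 = true := by
  decide +kernel

set_option maxHeartbeats 400000 in
/-- kernel fact: the channel check passes at `L = 50` (`2aKer(2,0) ≤ 1`, `4aKer(1,1) − 2aKer(2,0) ≤ 1` at `g_50 ≥ ¾ε₁(50)`). [folklore] -/
theorem chanCheck_50 : chanCheck 50 = true := by
  decide +kernel

set_option maxHeartbeats 400000 in
/-- kernel fact: the channel check passes at `L = 51` (`2aKer(2,0) ≤ 1`, `4aKer(1,1) − 2aKer(2,0) ≤ 1` at `g_51 ≥ ¾ε₁(51)`). [folklore] -/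
theorem chanCheck_51 : chanCheck 51 = true := by
  decide +kernel

set_option maxHeartbeats 400000 in
/-- kernel fact: the channel check passes at `L = 52` (`2aKer(2,0) ≤ 1`, `4aKer(1,1) − 2aKer(2,0) ≤ 1` at `g_52 ≥ ¾ε₁(52)`). [folklore] -/
theorem chanCheck_52 : chanCheck 52 = true := by
  decide +kernel

set_option maxHeartbeats 400000 in
/-- kernel fact: the channel check passes at `L = 53` (`2aKer(2,0) ≤ 1`, `4aKer(1,1) − 2aKer(2,0) ≤ 1` at `g_53 ≥ ¾ε₁(53)`). [folklore] -/
theorem chanCheck_53 : chanCheck 53 = true := by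
  decide +kernel

set_option maxHeartbeats 400000 in
/-- kernel fact: the channel check passes at `L = 54` (`2aKer(2,0) ≤ 1`, `4aKer(1,1) − 2aKer(2,0) ≤ 1` at `g_54 ≥ ¾ε₁(54)`). [folklore] -/
theorem chanCheck_54 : chanCheck 54 = true := by
  decide +kernel

end Hole2

end Summit.HubbardSuperconductivity.HubbardSuperconductivity.Theorems.AnisotropyChord.Transfer.Fibre3
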